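import Summits.QuantumFields.BalabanUV.T4Continuum.Support.NE7TanCriticalGauge
import Summits.QuantumFields.BalabanUV.T4Continuum.Support.NE3FrameFreeDecompositionLinear
import Summits.QuantumFields.BalabanUV.T4Continuum.Support.NE7LatticeLandauMinimiser
import Summits.QuantumFields.BalabanUV.T4Continuum.Support.NE3BlockLineAverage
import Summits.QuantumFields.BalabanUV.T4Continuum.Support.PeriodicChoice
import HarnessLib

/-!
# NE7TangentCriticalCover — TANGENT-CRITICALITY LIFTS TO EVERY COVER OF THE TORUS: a configuration `U` of period
# `P = L^{k+1}·N` that is critical along the `P`-periodic tangent directions of the fibre of the `(k+1)`-fold average is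
# critical along the `m·P`-periodic tangent directions, for every `m ≥ 1` (the test field is averaged over the deck group)

Cell `pub-balaban`, rung (B)+1 sub-cell t4, lineage `b2b-balaban-t4-ne7-p2`, generation 89 (CRUX PROVER NE7 #2 = co-owner of row NE7,
kernel hand), file (C1) of the gen-89 line «the (APE) END along the FLAT STRATUM by the cover trick».
WHY.  The OWNER's (APE) END at the trivial flat datum (t4-ne7-p1 g74, ROAD v4, `NE7ApeTrivialFlatEndCritical.smallField_of_tanCritical_flatTop`:
tangent-critical + flat top + small field ⟹ `SmallField U (K′δ²∕M²)`) has its constants `K′, θ` quantified BEFORE the number of blocks `N`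
— it is `N`-UNIFORM.  A flat coarse datum with holonomy of finite order `m` becomes a PURE GAUGE on the `m`-fold cover of the torus
(tree `NE7EtaBackgroundFlatStratum`: flat `N`-periodic data are `1^{w}` with `w` quasi-periodic; `w` is `(N·m)`-periodic iff the
holonomy constants have order `m`), and every hypothesis of the END is insensitive to passing to the cover EXCEPT tangent-criticality:
on the cover the END asks criticality against the LARGER space of `m·P`-periodic tangent directions.  THIS FILE supplies exactly that:
criticality against `P`-periodic tangents implies criticality against `m·P`-periodic tangents.
THE ARGUMENT (deck-group averaging; every step a tree lemma BY NAME).  For a skew `m·P`-periodic `φ` with `D_U φ = 0`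
(`D_U = dirIter L (k+1) U`) put `φ̄ := Σ_{s ∈ [0,m)^d} φ(· − P•s)`.  (i) `φ̄` is skew and `P`-PERIODIC (the shift by `P e_κ` permutes
the deck translations modulo `m·P`, `NE7LatticeLandauMinimiser.sum_periodBox_shift_vec`).  (ii) `D_U φ̄ = Σ_s (D_U φ)(· − N•s) = 0`:
ADDITIVITY of the linearised average through the tower in the multi-level small-field class (`NE3TangentCovariantTower.dirIter_add`)
and its TRANSLATION COVARIANCE (§2 `dirIter_shiftDir`, from `AveragingDeficitLiftPeriodic.pushDir_shift`∕`bavg_shift`: a fine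
translation by `L^{j}•v` of the direction is a coarse translation by `v` of its `j`-fold linearised average, for `L^{j}•v`-invariant `U`).
(iii) `dAction U φ̄ (perWin P) = 0` by the hypothesis.  (iv) The first-variation density of `(U, φ̄)` is `P`-periodic, so its sum over
the `m·P`-box is `m^d` times its sum over the `P`-box (`NE3BlockLineAverage.sum_periodBox_blocks`): `dAction U φ̄ (perWin (m·P)) = 0`.
(v) `dAction U φ̄ (perWin (m·P)) = Σ_s dAction U (φ(· − P•s)) (perWin (m·P)) = m^d · dAction U φ (perWin (m·P))` (`NE7ExactCurrent.dAction_add`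
+ translation covariance of the density §3 + shift-invariance of torus sums).  Hence `dAction U φ (perWin (m·P)) = 0`.
WHAT ([folklore]; 0 def, 0 sorry; every `d`, `L ≥ 1`, every `n`).  §1 periods: `invariant_smul_of_isPeriodicCfg`, `dir_invariant_smul_of_isPeriodicDir`,
`isPeriodicCfg_mul`, `isPeriodicDir_mul`, `isPeriodicDir_shiftDir`, `isSkewDir_shiftDir`; §2 translation covariance of the tower: `cavg_shift_invariant`,
`cpush_shiftDir`, **`dirIter_shiftDir`**, `dirIter_finset_sum`; §3 the first variation: `curl_shiftDir`, `fhol_shift_invariant`, `sum_perWin`,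
`dAction_perWin_eq`, `density_add_period`, `dAction_shiftDir_perWin`, `dAction_finset_sum`, `sum_periodBox_mul_of_periodic`, `dAction_perWin_mul`; §4 the
deck sum: `isSkewDir_deckSum`, `isPeriodicDir_deckSum`; §5 **`tanCritical_cover`** (period `L^{k+1}·N` ⟹ period `L^{k+1}·(N·m)`, every `m ≥ 1`).
HONEST FRAMING (page 1): elementary lattice bookkeeping — a composition of tree lemmas BY NAME; nothing of Bałaban's is asserted; it moves NO
letter of the (APE)-bill by itself (its consumer is the gen-89 END `NE7ApeFlatToronEnd` at flat data with finite-order holonomy); (APE) on the data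
class NOT proved; NE7 NOT PRINTED ∕ NOT PROVED; spine PROVED 0∕9; FIXED FINITE T⁴, rung (B)+1 — NOT infinite volume, NOT mass gap, NOT BetaPertH,
NOT Clay.  Continuum YM on T⁴ ⇐ BetaPertH ∧ nine spine estimates (0/9 proved); BetaPertH ⇐ (D1) ∧ (D4) ∧ CAP+tail; G-an2-4 gates asym, D1 and NE2/3/4.
-/

set_option autoImplicit false

open scoped BigOperators Matrix.Norms.L2Operator
open Finset

namespace Summit.QuantumFields.BalabanUV.T4Continuum.NE7TangentCriticalCover

open Literature.MathematicalPhysics.QuantumFieldTheory.Balaban1983to89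
open B7Prop1Explicit B7Prop2Explicit UnitaryModel
open T4AveragingDeficitWall (IsUnitaryCfg IsSkewDir SmallField Ad curl curlAt fhol nReTrL nReTrL_apply)
open T4AveragingDeficitWallBoundary (IsPeriodicCfg periodBox mem_periodBox)
open AveragingDeficitPeriodicCounting (IsPeriodicDir curl_add_period fhol_add_period)
open AveragingDeficitChartCalculus (cavg)
open AveragingDeficitMultiLevelPrep (cpush cavgIter LevelSmall)
open AveragingDeficitResidualPairing (pushDir)
open AveragingDeficitLiftPeriodic (shiftDir pushDir_shift bavg_shift hol_shift)
open MinimalActionLevels (perWin)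
open NE3HessForm (dAction)
open NE3TangentCovariantTower (dirIter dirIter_succ dirIter_add step_small)
open NE3FrameFreeDecompositionLinear (dirIter_zero_dir)
open NE7ExactCurrent (dAction_add)
open NE7LatticeLandauMinimiser (sum_periodBox_shift_vec)
open NE3BlockLineAverage (sum_periodBox_blocks)
open PeriodicChoice (periodic_vec)

noncomputable section

variable {d : ℕ} {n : Type*} [Fintype n] [DecidableEq n]

/-! ## §1 Periods: a `P`-periodic object is `P·m`-periodic and invariant under every vector of the period lattice -/

/-- A `P`-periodic configuration is invariant under every vector `P•s` of the period lattice. [folklore] -/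
theorem invariant_smul_of_isPeriodicCfg {U : Site d → Fin d → (Matrix n n ℂ)ˣ} {P : ℤ} (hU : IsPeriodicCfg U P) (s : Site d) :
    ∀ (x : Site d) (μ : Fin d), U (x + P • s) μ = U x μ := by
  intro x μ
  have h := periodic_vec (g := U) (N := P) (fun y κ => funext fun ν => hU y κ ν) x s
  exact congr_fun h μ

omit [Fintype n] [DecidableEq n] in
/-- A `P`-periodic direction is invariant under every vector `P•s` of the period lattice. [folklore] -/
theorem dir_invariant_smul_of_isPeriodicDir {φ : Site d → Fin d → Matrix n n ℂ} {P : ℤ} (hφ : IsPeriodicDir φ P) (s : Site d) :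
    ∀ (x : Site d) (μ : Fin d), φ (x + P • s) μ = φ x μ := by
  intro x μ
  have h := periodic_vec (g := φ) (N := P) (fun y κ => funext fun ν => hφ y κ ν) x s
  exact congr_fun h μ

/-- A `P`-periodic configuration is `P·m`-periodic. [folklore] -/
theorem isPeriodicCfg_mul {U : Site d → Fin d → (Matrix n n ℂ)ˣ} {P : ℤ} (hU : IsPeriodicCfg U P) (m : ℤ) :
    IsPeriodicCfg U (P * m) := by
  intro x κ μ
  have h := invariant_smul_of_isPeriodicCfg hU (m • e κ) x μ
  rwa [smul_smul] at h

omit [Fintype n] [DecidableEq n] in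
/-- A `P`-periodic direction is `P·m`-periodic. [folklore] -/
theorem isPeriodicDir_mul {φ : Site d → Fin d → Matrix n n ℂ} {P : ℤ} (hφ : IsPeriodicDir φ P) (m : ℤ) :
    IsPeriodicDir φ (P * m) := by
  intro x κ μ
  have h := dir_invariant_smul_of_isPeriodicDir hφ (m • e κ) x μ
  rwa [smul_smul] at h

omit [Fintype n] [DecidableEq n] in
/-- The translate of a `Q`-periodic direction is `Q`-periodic. [folklore] -/
theorem isPeriodicDir_shiftDir {φ : Site d → Fin d → Matrix n n ℂ} {Q : ℤ} (hφ : IsPeriodicDir φ Q) (t : Site d) :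
    IsPeriodicDir (shiftDir t φ) Q := by
  intro x κ μ
  simp only [shiftDir]
  rw [add_sub_right_comm, hφ]

omit [Fintype n] [DecidableEq n] in
/-- The translate of a skew direction is skew. [folklore] -/
theorem isSkewDir_shiftDir {φ : Site d → Fin d → Matrix n n ℂ} (hφ : IsSkewDir φ) (t : Site d) : IsSkewDir (shiftDir t φ) :=
  fun x κ => hφ (x - t) κ

/-! ## §2 Translation covariance of the linearised average through the tower -/

/-- The average of an `L•v`-invariant configuration is `v`-invariant on the coarse unit lattice. [cite: Balaban1985Averaging, (42) p.23] -/
theorem cavg_shift_invariant (L : ℕ) {W : Site d → Fin d → (Matrix n n ℂ)ˣ} {v : Site d}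
    (hW : ∀ (x : Site d) (μ : Fin d), W (x + (L : ℤ) • v) μ = W x μ) :
    ∀ (y : Site d) (κ : Fin d), cavg L W (y + v) κ = cavg L W y κ := by
  intro y κ
  show bavg L W ((L : ℤ) • (y + v)) κ = bavg L W ((L : ℤ) • y) κ
  rw [smul_add]
  exact bavg_shift L hW _ κ

/-- **THE DIFFERENTIAL OF THE AVERAGE IS TRANSLATION COVARIANT on the unit lattices**: for `L•v`-invariant `W`,
`cpush L W (φ(· − L•v)) = (cpush L W φ)(· − v)`. [cite: Balaban1985Averaging, (42) p.23] -/
theorem cpush_shiftDir (L : ℕ) {W : Site d → Fin d → (Matrix n n ℂ)ˣ} {v : Site d}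
    (hW : ∀ (x : Site d) (μ : Fin d), W (x + (L : ℤ) • v) μ = W x μ) (φ : Site d → Fin d → Matrix n n ℂ) :
    cpush L W (shiftDir ((L : ℤ) • v) φ) = shiftDir v (cpush L W φ) := by
  funext y κ
  show pushDir L W (shiftDir ((L : ℤ) • v) φ) ((L : ℤ) • y) κ = pushDir L W φ ((L : ℤ) • (y - v)) κ
  have h := pushDir_shift L hW φ ((L : ℤ) • (y - v)) κ
  rw [← smul_add, sub_add_cancel] at h
  exact h

/-- **THE `j`-FOLD LINEARISED AVERAGE IS TRANSLATION COVARIANT**: for `L^{j}•v`-invariant `W`,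
`dirIter L j W (φ(· − L^{j}•v)) = (dirIter L j W φ)(· − v)`. [folklore] -/
theorem dirIter_shiftDir (L : ℕ) : ∀ (j : ℕ) {W : Site d → Fin d → (Matrix n n ℂ)ˣ} {v : Site d},
    (∀ (x : Site d) (μ : Fin d), W (x + ((L : ℤ) ^ j) • v) μ = W x μ) → ∀ (φ : Site d → Fin d → Matrix n n ℂ),
    dirIter L j W (shiftDir (((L : ℤ) ^ j) • v) φ) = shiftDir v (dirIter L j W φ)
  | 0, W, v, _, φ => by simp only [pow_zero, one_smul]; rfl
  | j + 1, W, v, hW, φ => by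
      have hpow : ((L : ℤ) ^ (j + 1)) • v = (L : ℤ) • (((L : ℤ) ^ j) • v) := by
        rw [smul_smul, ← pow_succ']
      have hW' : ∀ (x : Site d) (μ : Fin d), W (x + (L : ℤ) • (((L : ℤ) ^ j) • v)) μ = W x μ := by
        intro x μ; rw [← hpow]; exact hW x μ
      rw [dirIter_succ, dirIter_succ, hpow, cpush_shiftDir L hW' φ]
      exact dirIter_shiftDir L j (cavg_shift_invariant L hW') (cpush L W φ)

/-- **ADDITIVITY OVER FINITE SUMS THROUGH THE TOWER** (the tree's binary `dirIter_add`, iterated): in the multi-level small-field class,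
`dirIter L (j+1) W (Σ_{s∈S} F s) = Σ_{s∈S} dirIter L (j+1) W (F s)`. [folklore] -/
theorem dirIter_finset_sum [Nonempty n] {L : ℕ} (hL : 1 ≤ L) (j : ℕ) {W : Site d → Fin d → (Matrix n n ℂ)ˣ} {x : ℝ}
    (hWu : IsUnitaryCfg W) (hx : 0 ≤ x) (hs : LevelSmall d L j x) (hWx : SmallField W x)
    {ι : Type*} (S : Finset ι) (F : ι → Site d → Fin d → Matrix n n ℂ) :
    dirIter L (j + 1) W (fun y μ => ∑ s ∈ S, F s y μ) = fun z κ => ∑ s ∈ S, dirIter L (j + 1) W (F s) z κ := by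
  classical
  induction S using Finset.induction_on with
  | empty =>
      simp only [Finset.sum_empty]
      exact dirIter_zero_dir hL j hWu hx hs hWx
  | insert a S ha ih =>
      have hsplit : (fun y μ => ∑ s ∈ insert a S, F s y μ) = fun y μ => F a y μ + (fun y' μ' => ∑ s ∈ S, F s y' μ') y μ := by
        funext y μ; rw [Finset.sum_insert ha]
      rw [hsplit, dirIter_add hL j hWu hx hs hWx, ih]
      funext z κ
      rw [Finset.sum_insert ha]

/-! ## §3 Translation covariance of the first variation; torus sums -/

/-- The dressed curl of the translated direction is the translated dressed curl (for `t`-invariant `U`). [folklore] -/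
theorem curl_shiftDir {U : Site d → Fin d → (Matrix n n ℂ)ˣ} {t : Site d} (hU : ∀ (x : Site d) (μ : Fin d), U (x + t) μ = U x μ)
    (φ : Site d → Fin d → Matrix n n ℂ) (x : Site d) (π : T4AveragingDeficitWall.Plane d) :
    curl U (shiftDir t φ) (x + t, π) = curl U φ (x, π) := by
  show curlAt U (shiftDir t φ) (x + t) π.1.1 π.1.2 = curlAt U φ x π.1.1 π.1.2
  simp only [curlAt, shiftDir, add_right_comm x t, hU, add_sub_cancel_right]

/-- The plaquette variable at a translated corner (for `t`-invariant `U`). [folklore] -/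
theorem fhol_shift_invariant {U : Site d → Fin d → (Matrix n n ℂ)ˣ} {t : Site d} (hU : ∀ (x : Site d) (μ : Fin d), U (x + t) μ = U x μ)
    (x : Site d) (π : T4AveragingDeficitWall.Plane d) : fhol U (x + t, π) = fhol U (x, π) :=
  hol_shift hU _ _

omit [Fintype n] [DecidableEq n] in
/-- The period window is the product of the period box with the planes: sums over it are iterated sums. [folklore] -/
theorem sum_perWin {α : Type*} [AddCommMonoid α] (Q : ℕ) (f : T4AveragingDeficitWall.Plaq d → α) :
    ∑ p ∈ perWin d Q, f p = ∑ x ∈ periodBox (d := d) Q, ∑ π : T4AveragingDeficitWall.Plane d, f (x, π) := by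
  unfold perWin
  rw [Finset.sum_product]

/-- `dAction` over the period window as a sum of a SITE DENSITY. [folklore] -/
theorem dAction_perWin_eq (U : Site d → Fin d → (Matrix n n ℂ)ˣ) (φ : Site d → Fin d → Matrix n n ℂ) (Q : ℕ) :
    dAction U φ (perWin d Q)
      = ∑ x ∈ periodBox (d := d) Q, ∑ π : T4AveragingDeficitWall.Plane d,
          -nReTr (curl U φ (x, π) * ((fhol U (x, π) : (Matrix n n ℂ)ˣ) : Matrix n n ℂ)) := by
  unfold dAction
  rw [← Finset.sum_neg_distrib, sum_perWin]

/-- The first-variation site density of periodic data is periodic. [folklore] -/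
theorem density_add_period {U : Site d → Fin d → (Matrix n n ℂ)ˣ} {φ : Site d → Fin d → Matrix n n ℂ} {Q : ℤ} (hU : IsPeriodicCfg U Q)
    (hφ : IsPeriodicDir φ Q) (x : Site d) (κ : Fin d) :
    (∑ π : T4AveragingDeficitWall.Plane d, -nReTr (curl U φ (x + Q • e κ, π) * ((fhol U (x + Q • e κ, π) : (Matrix n n ℂ)ˣ) : Matrix n n ℂ)))
      = ∑ π : T4AveragingDeficitWall.Plane d, -nReTr (curl U φ (x, π) * ((fhol U (x, π) : (Matrix n n ℂ)ˣ) : Matrix n n ℂ)) := by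
  refine Finset.sum_congr rfl fun π _ => ?_
  rw [curl_add_period hU hφ, fhol_add_period hU]

/-- **THE FIRST VARIATION ALONG A DECK TRANSLATE EQUALS THE FIRST VARIATION**: for `U` and `φ` of period `Q` and a translation `t` leaving `U`
invariant, `dAction U (φ(· − t)) (perWin Q) = dAction U φ (perWin Q)`. [folklore] -/
theorem dAction_shiftDir_perWin {U : Site d → Fin d → (Matrix n n ℂ)ˣ} {φ : Site d → Fin d → Matrix n n ℂ} {Q : ℕ} (hQ : 1 ≤ Q)
    (hUQ : IsPeriodicCfg U (Q : ℤ)) (hφQ : IsPeriodicDir φ (Q : ℤ)) {t : Site d}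
    (hUt : ∀ (x : Site d) (μ : Fin d), U (x + t) μ = U x μ) :
    dAction U (shiftDir t φ) (perWin d Q) = dAction U φ (perWin d Q) := by
  rw [dAction_perWin_eq, dAction_perWin_eq]
  -- the density of the translate is the translate of the density
  have hdens : ∀ x : Site d,
      (∑ π : T4AveragingDeficitWall.Plane d, -nReTr (curl U (shiftDir t φ) (x, π) * ((fhol U (x, π) : (Matrix n n ℂ)ˣ) : Matrix n n ℂ)))
        = ∑ π : T4AveragingDeficitWall.Plane d, -nReTr (curl U φ (x + -t, π) * ((fhol U (x + -t, π) : (Matrix n n ℂ)ˣ) : Matrix n n ℂ)) := by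
    intro x
    refine Finset.sum_congr rfl fun π _ => ?_
    have h1 := curl_shiftDir hUt φ (x + -t) π
    have h2 := fhol_shift_invariant hUt (x + -t) π
    rw [neg_add_cancel_right] at h1 h2
    rw [h1, h2]
  simp_rw [hdens]
  exact sum_periodBox_shift_vec hQ (g := fun x => ∑ π : T4AveragingDeficitWall.Plane d,
    -nReTr (curl U φ (x, π) * ((fhol U (x, π) : (Matrix n n ℂ)ˣ) : Matrix n n ℂ))) (fun x κ => density_add_period hUQ hφQ x κ) (-t)

/-- `dAction` is additive over finite sums of directions. [folklore] -/
theorem dAction_finset_sum (U : Site d → Fin d → (Matrix n n ℂ)ˣ) {ι : Type*} (S : Finset ι) (F : ι → Site d → Fin d → Matrix n n ℂ)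
    (W : Finset (T4AveragingDeficitWall.Plaq d)) :
    dAction U (fun y μ => ∑ s ∈ S, F s y μ) W = ∑ s ∈ S, dAction U (F s) W := by
  classical
  induction S using Finset.induction_on with
  | empty =>
      simp only [Finset.sum_empty]
      unfold dAction
      rw [neg_eq_zero]
      refine Finset.sum_eq_zero fun p _ => ?_
      have h0 : curl U (fun (_ : Site d) (_ : Fin d) => (0 : Matrix n n ℂ)) p = 0 := by
        show curlAt U _ p.1 p.2.1.1 p.2.1.2 = 0
        simp [curlAt, Ad]
      rw [h0, zero_mul, ← nReTrL_apply, map_zero]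
  | insert a S ha ih =>
      have hsplit : (fun y μ => ∑ s ∈ insert a S, F s y μ) = F a + fun y μ => ∑ s ∈ S, F s y μ := by
        funext y μ; rw [Finset.sum_insert ha]; rfl
      rw [hsplit, dAction_add, ih, Finset.sum_insert ha]

/-- **A PERIODIC DENSITY SUMS OVER THE `m`-FOLD BOX TO `m^d` COPIES**: for a `P`-periodic site function `g`,
`Σ_{x∈[0,P·m)^d} g x = #[0,m)^d • Σ_{x∈[0,P)^d} g x`. [folklore] -/
theorem sum_periodBox_mul_of_periodic {α : Type*} [AddCommMonoid α] {P : ℕ} (hP : 1 ≤ P) (m : ℕ) {g : Site d → α}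
    (hg : ∀ (x : Site d) (κ : Fin d), g (x + (P : ℤ) • e κ) = g x) :
    ∑ x ∈ periodBox (d := d) (P * m), g x = (periodBox (d := d) m).card • ∑ x ∈ periodBox (d := d) P, g x := by
  rw [← sum_periodBox_blocks P m hP g, ← Finset.sum_const]
  refine Finset.sum_congr rfl fun y _ => Finset.sum_congr rfl fun v _ => ?_
  rw [add_comm]
  exact periodic_vec (g := g) (N := (P : ℤ)) hg v y

/-- The first variation over the `m`-fold period window is `#[0,m)^d` times the first variation over the period window, for `P`-periodic data.
[folklore] -/
theorem dAction_perWin_mul {U : Site d → Fin d → (Matrix n n ℂ)ˣ} {φ : Site d → Fin d → Matrix n n ℂ} {P : ℕ} (hP : 1 ≤ P) (m : ℕ)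
    (hUP : IsPeriodicCfg U (P : ℤ)) (hφP : IsPeriodicDir φ (P : ℤ)) :
    dAction U φ (perWin d (P * m)) = ((periodBox (d := d) m).card : ℝ) * dAction U φ (perWin d P) := by
  rw [dAction_perWin_eq, dAction_perWin_eq, sum_periodBox_mul_of_periodic hP m (fun x κ => density_add_period hUP hφP x κ),
    nsmul_eq_mul]

/-! ## §4 The deck sum of a direction -/

omit [Fintype n] [DecidableEq n] in
/-- The deck sum `Σ_{s∈[0,m)^d} φ(· − P•s)` of a skew direction is skew. [folklore] -/
theorem isSkewDir_deckSum {φ : Site d → Fin d → Matrix n n ℂ} (hφ : IsSkewDir φ) (P : ℤ) (m : ℕ) :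
    IsSkewDir (fun y μ => ∑ s ∈ periodBox (d := d) m, shiftDir (P • s) φ y μ) := by
  intro y μ
  exact sum_mem fun s _ => isSkewDir_shiftDir hφ _ y μ

omit [Fintype n] [DecidableEq n] in
/-- **THE DECK SUM OF AN `m·P`-PERIODIC DIRECTION IS `P`-PERIODIC**. [folklore] -/
theorem isPeriodicDir_deckSum {φ : Site d → Fin d → Matrix n n ℂ} {P : ℕ} {m : ℕ} (hm : 1 ≤ m)
    (hφ : IsPeriodicDir φ (((P * m : ℕ) : ℤ))) :
    IsPeriodicDir (fun y μ => ∑ s ∈ periodBox (d := d) m, shiftDir ((P : ℤ) • s) φ y μ) (P : ℤ) := by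
  intro y κ μ
  simp only [shiftDir]
  -- `s ↦ φ(y − P•s) μ` is `m`-periodic in `s`
  have hg : ∀ (s : Site d) (κ' : Fin d), (fun s' : Site d => φ (y - (P : ℤ) • s') μ) (s + (m : ℤ) • e κ') =
      (fun s' : Site d => φ (y - (P : ℤ) • s') μ) s := by
    intro s κ'
    simp only
    have hper := hφ (y - (P : ℤ) • s - (((P * m : ℕ) : ℤ)) • e κ') κ' μ
    rw [sub_add_cancel] at hper
    rw [hper]
    congr 1
    rw [smul_add, smul_smul]
    push_cast
    abel
  have hshift := sum_periodBox_shift_vec hm (g := fun s' : Site d => φ (y - (P : ℤ) • s') μ) hg (-e κ)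
  rw [← hshift]
  refine Finset.sum_congr rfl fun s _ => ?_
  congr 1
  rw [smul_add, smul_neg]
  abel

/-! ## §5 THE COVER TRANSFER OF TANGENT-CRITICALITY -/

/-- **TANGENT-CRITICALITY LIFTS TO THE `m`-FOLD COVER.**  For unitary `U` of period `P = L^{k+1}·N` in the multi-level small-field class
(`LevelSmall d L k x`, `SmallField U x`): if `dAction U φ (perWin P) = 0` for every skew `P`-periodic `φ` with `dirIter L (k+1) U φ = 0`, then
`dAction U φ (perWin (L^{k+1}·(N·m))) = 0` for every skew `L^{k+1}·(N·m)`-periodic `φ` with `dirIter L (k+1) U φ = 0`, for every `m ≥ 1` — the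
shape of the OWNER's END `NE7ApeTrivialFlatEndCritical.smallField_of_tanCritical_flatTop` read at `N·m` blocks. [folklore] -/
theorem tanCritical_cover [Nonempty n] {L : ℕ} (hL : 1 ≤ L) (k : ℕ) {N : ℕ} (hN : 1 ≤ N) {m : ℕ} (hm : 1 ≤ m)
    {U : Site d → Fin d → (Matrix n n ℂ)ˣ} (hU : IsUnitaryCfg U) {x : ℝ} (hx : 0 ≤ x) (hs : LevelSmall d L k x) (hUx : SmallField U x)
    (hUP : IsPeriodicCfg U ((L ^ (k + 1) * N : ℕ) : ℤ))
    (hcrit : ∀ φ : Site d → Fin d → Matrix n n ℂ, IsSkewDir φ → IsPeriodicDir φ ((L ^ (k + 1) * N : ℕ) : ℤ) →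
      dirIter L (k + 1) U φ = 0 → dAction U φ (perWin d (L ^ (k + 1) * N)) = 0) :
    ∀ φ : Site d → Fin d → Matrix n n ℂ, IsSkewDir φ → IsPeriodicDir φ ((L ^ (k + 1) * (N * m) : ℕ) : ℤ) →
      dirIter L (k + 1) U φ = 0 → dAction U φ (perWin d (L ^ (k + 1) * (N * m))) = 0 := by
  intro φ hφs hφP hφT
  -- the period `P` and the cover period `P·m`
  set P : ℕ := L ^ (k + 1) * N with hPdef
  have hPm : L ^ (k + 1) * (N * m) = P * m := by rw [hPdef, Nat.mul_assoc]
  rw [hPm] at hφP ⊢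
  have hL0 : 0 < L := hL
  have hP1 : 1 ≤ P := Nat.one_le_iff_ne_zero.mpr (Nat.mul_ne_zero (pow_ne_zero _ hL0.ne') (by omega))
  have hUPm : IsPeriodicCfg U (((P * m : ℕ) : ℤ)) := by
    have h := isPeriodicCfg_mul hUP (m : ℤ)
    push_cast at h ⊢
    exact h
  -- the deck sum
  set φbar : Site d → Fin d → Matrix n n ℂ := fun y μ => ∑ s ∈ periodBox (d := d) m, shiftDir ((P : ℤ) • s) φ y μ with hφbar
  have hbs : IsSkewDir φbar := isSkewDir_deckSum hφs (P : ℤ) m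
  have hbP : IsPeriodicDir φbar (P : ℤ) := isPeriodicDir_deckSum hm hφP
  -- (ii) `D_U φ̄ = 0`
  have hUinv : ∀ s : Site d, ∀ (y : Site d) (μ : Fin d), U (y + ((L : ℤ) ^ (k + 1)) • ((N : ℤ) • s)) μ = U y μ := by
    intro s y μ
    have h := invariant_smul_of_isPeriodicCfg hUP s y μ
    rw [smul_smul]
    exact_mod_cast h
  have hbT : dirIter L (k + 1) U φbar = 0 := by
    rw [hφbar, dirIter_finset_sum hL k hU hx hs hUx]
    funext z κ
    refine Finset.sum_eq_zero fun s _ => ?_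
    have hPs : ((P : ℤ)) • s = ((L : ℤ) ^ (k + 1)) • ((N : ℤ) • s) := by
      rw [smul_smul, hPdef]; push_cast; ring_nf
    rw [hPs, dirIter_shiftDir L (k + 1) (hUinv s) φ, hφT]
    rfl
  -- (iii) criticality at period `P` against `φ̄`
  have hcritbar : dAction U φbar (perWin d P) = 0 := hcrit φbar hbs hbP hbT
  -- (iv) over the cover window
  have hbig : dAction U φbar (perWin d (P * m)) = 0 := by
    rw [dAction_perWin_mul hP1 m hUP hbP, hcritbar, mul_zero]
  -- (v) the deck translates all have the same first variation
  have hsum : dAction U φbar (perWin d (P * m)) = ((periodBox (d := d) m).card : ℝ) * dAction U φ (perWin d (P * m)) := by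
    rw [hφbar, dAction_finset_sum]
    have hPm1 : 1 ≤ P * m := Nat.one_le_iff_ne_zero.mpr (Nat.mul_ne_zero (by omega) (by omega))
    have hterm : ∀ s ∈ periodBox (d := d) m, dAction U (shiftDir ((P : ℤ) • s) φ) (perWin d (P * m)) = dAction U φ (perWin d (P * m)) := by
      intro s _
      refine dAction_shiftDir_perWin hPm1 hUPm hφP ?_
      exact invariant_smul_of_isPeriodicCfg hUP s
    rw [Finset.sum_congr rfl hterm, Finset.sum_const, nsmul_eq_mul]
  have hcard : ((periodBox (d := d) m).card : ℝ) ≠ 0 := by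
    have h0 : (0 : Site d) ∈ periodBox (d := d) m :=
      mem_periodBox.mpr fun κ => ⟨le_rfl, by show (0 : ℤ) < (m : ℤ); omega⟩
    exact_mod_cast (Finset.card_pos.mpr ⟨0, h0⟩).ne'
  have := hbig
  rw [hsum] at this
  exact (mul_eq_zero.mp this).resolve_left hcard

end

end Summit.QuantumFields.BalabanUV.T4Continuum.NE7TangentCriticalCover
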